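import Summits.Ventures.CertifiedManyBodySolver.Theorems.M3x2EdgeSplitSymReplaySoundD
import HarnessLib

/-!
# SymReplay S4 `stub_soundOfKernels` PROVED, and the UNCONDITIONAL corollary `energyDensity_ge_symValue : symCheck K = true → symValue K ≤ e₀(1,0,8,7/8)` (S6 = `WardSlot.stub_wardWindowSound`); `toyCert_energy_ge : −23/4 ≤ e₀` (T10; hub-lb-sym-eng-3)
No summit or crux statement is proved here; no certificate beyond toys is replayed; nothing here predicts superconductivity.
-/

noncomputable section

namespace Summit.Ventures.CertifiedManyBodySolver.Theorems.SymReplay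

open Matrix Finset
open Literature.MathematicalPhysics.QuantumLattice
open Literature.MathematicalPhysics.QuantumLattice.HubbardWave0
open Literature.MathematicalPhysics.QuantumLattice.ThermodynamicLimit
open Literature.Probability.LatticeModels
open Literature.MathematicalPhysics.QuantumManyBody.StateRelaxation
open Summit.Ventures.CertifiedManyBodySolver.Theorems.WardSlot
open scoped ComplexOrder BigOperators

/-- Ward × `D₄` window soundness + a window certificate of value `≥ q` ⇒ `q ≤ e₀(1, 0, 8, 7/8)`
(wardk's `energyDensity_ge_of_wardCert` with its first three hypotheses contracted to `WardD4WindowSound`). -/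
theorem energyDensity_ge_of_windowSound_cert (q : ℝ) (hS : WardD4WindowSound) (h4 : WardD4CertGe q) :
    q ≤ energyDensityTT' 1 0 8 (7 / 8) := by
  obtain ⟨Λ, Λ', hΛ, h8, h0, hz, μ, nm, Λm, hΛm, O, ns, B, nt, γ, wv, hsh, Y, nu, b, cw, hcw,
    np, Xp, nm', Xm, na, dc, V, nw, a, word, c, hcert, hval⟩ := h4
  have hb := hS 1 0 8 (by norm_num) (7 / 8) (by norm_num) (by norm_num) Λ Λ' hΛ h8 h0 hz μ
    (Fin nm) inferInstance inferInstance Λm hΛm O (Fin ns) Finset.univ B (Fin nt) Finset.univ γ wv hsh Y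
    (Fin nu) Finset.univ b cw hcw (Fin np) Finset.univ Xp (Fin nm') Finset.univ Xm
    (Fin na) Finset.univ dc V (Fin nw) Finset.univ a word c hcert
  linarith

/-- **S4 — the word-form checker is SOUND**: given the three algebra kernels S1–S3, every certificate passing
`symCheck` is a Ward × affine-`D₄` window certificate of value `symValue K` (`WardD4CertGe`).  Witness: `Λ := frame`,
`Λ' := (bigFrame K).toList.toFinset`; the identity is read in `𝔄_{Λ'}`; frame-level commutators transferred by graded
locality; the canonicaliser's per-word identifications and the explicit `moves` form the `tt` family; Gram =
`gramMat K` re-indexed by `Fin`. -/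
theorem stub_soundOfKernels : NfFaithful → MoveSound → DictionarySound → SymCheckSound := by
  intro h1 _ h3 K hK
  /- (0) unpack the checker's verdict -/
  have hK' := hK
  rw [symCheck, Bool.and_eq_true] at hK'
  obtain ⟨hwf, hid⟩ := hK'
  simp only [wellFormed, Bool.and_eq_true] at hwf
  obtain ⟨⟨⟨⟨⟨⟨⟨⟨⟨⟨⟨⟨⟨hnd, hz0⟩, hn0⟩, hIF⟩, hth⟩, hgram⟩, hgM⟩, heom⟩, hmov⟩, hch⟩, hwp⟩, hwm⟩, hah⟩, hsl⟩ := hwf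
  have hgram' : ∀ g ∈ K.gram, 0 ≤ g.1 ∧ psuppIn g.2 K.frame = true := fun g hg => by
    have h := List.all_eq_true.1 hgram g hg
    rw [Bool.and_eq_true, decide_eq_true_eq] at h
    exact h
  have hgM' : ∀ B ∈ K.gramM, 0 ≤ B.scale ∧ (∀ r ∈ B.rows, rowAsc r = true) ∧
      (∀ q ∈ B.basis, psuppIn q K.frame = true) := fun B hB => by
    have h := List.all_eq_true.1 hgM B hB
    simp only [gramBlockOK, Bool.and_eq_true, decide_eq_true_eq, List.all_eq_true] at h
    exact ⟨h.1.1.1, h.1.2, h.2⟩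
  have heom' : ∀ B ∈ K.eom, psuppIn B K.inner = true := fun B hB => List.all_eq_true.1 heom B hB
  have hmov' : ∀ mv ∈ K.moves, suppIn mv.u K.frame = true ∧ suppIn (moveWordF mv.γ mv.v mv.u) K.frame = true :=
    fun mv hmv => by
      have h := List.all_eq_true.1 hmov mv hmv
      rwa [Bool.and_eq_true] at h
  have hch' : ∀ t ∈ K.charged, suppIn t.2 K.frame = true ∧ (wordCharge t.2 ≠ 0 ∨ wordSpinCharge t.2 ≠ 0) :=
    fun t ht => by
      have h := List.all_eq_true.1 hch t ht
      rw [Bool.and_eq_true, Bool.or_eq_true] at h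
      exact ⟨h.1, h.2.imp bne_iff_ne.1 bne_iff_ne.1⟩
  have hwp' : ∀ X ∈ K.wardP, psuppIn X K.frame = true := fun X hX => List.all_eq_true.1 hwp X hX
  have hwm' : ∀ X ∈ K.wardM, psuppIn X K.frame = true := fun X hX => List.all_eq_true.1 hwm X hX
  have hah' : ∀ t ∈ K.antiH, psuppIn t.2 K.frame = true := fun t ht => List.all_eq_true.1 hah t ht
  have hsl' : ∀ t ∈ K.slack, suppIn t.2 K.frame = true := fun t ht => List.all_eq_true.1 hsl t ht
  /- (1) the frame `F`, the inner window `I ⊆ F`, the enlarged frame `Λ'⁺ = (bigFrame K).toList.toFinset` -/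
  have hIF' : K.inner.toFinset ⊆ K.frame.toFinset := fun x hx =>
    List.mem_toFinset.2 ((subSites_iff _ _).1 hIF x (List.mem_toFinset.1 hx))
  have hthF : thicken K.inner.toFinset 1 ⊆ K.frame.toFinset := thicken_subset_of_thick hth
  have h0F : thicken ({0} : Finset (Site 2)) 1 ⊆ K.frame.toFinset := by
    have h : subSites (thick [0]) K.frame = true := by simpa [thick] using hn0
    have h' := thicken_subset_of_thick h
    simpa using h'
  have hzF : (0 : Site 2) ∈ K.frame.toFinset := List.mem_toFinset.2 ((memSite_iff _ _).1 hz0)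
  have hL : (bigFrame K).toList.toFinset = bigFrame K := Finset.toList_toFinset _
  have hFL : K.frame.toFinset ⊆ (bigFrame K).toList.toFinset := by
    rw [hL]; exact (subset_thicken _ 1).trans (thicken_subset_bigFrame K)
  have h8 : thicken K.frame.toFinset 1 ⊆ (bigFrame K).toList.toFinset := by
    rw [hL]; exact thicken_subset_bigFrame K
  have h0 : thicken ({0} : Finset (Site 2)) 1 ⊆ (bigFrame K).toList.toFinset := h0F.trans hFL
  have hz : (0 : Site 2) ∈ (bigFrame K).toList.toFinset := hFL hzF
  have hfr : ∀ x ∈ K.frame, x ∈ (bigFrame K).toList.toFinset := fun x hx => hFL (List.mem_toFinset.2 hx)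
  have hndL : nodupSites (bigFrame K).toList = true := nodupSites_of_nodup _ (Finset.nodup_toList _)
  have hshf : ∀ l : Fin (ttList K).length,
      d4ShiftSet ((ttList K).get l).γ ((ttList K).get l).v K.frame.toFinset ⊆ (bigFrame K).toList.toFinset :=
    fun l => by rw [hL]; exact d4ShiftSet_subset_bigFrame K (List.get_mem _ l)
  /- (2) the dictionary (S3) in `F` and in `Λ'⁺`; supports; the residual equation -/
  obtain ⟨hHF, -, -, hSpF, hSmF⟩ := h3 K.frame hnd
  obtain ⟨-, hEL, hDL, -, -⟩ := h3 (bigFrame K).toList hndL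
  have hsR : PSupp (rhsPoly K) K.frame.toFinset := PSupp_rhsPoly K (fun g hg => (hgram' g hg).2)
    (fun B hB => (hgM' B hB).2.2) heom' hIF hmov' (fun t ht => (hch' t ht).1) hwp' hwm' hah' hsl'
  have hsL : PSupp (lhsPoly K) K.frame.toFinset := PSupp_lhsPoly K h0F
  have htt : ∀ e ∈ ttList K, SuppIn e.u K.frame.toFinset :=
    ttList_supp K hmov' (hsL.psub hsR).nfPoly.collect
  have hR := residual_expansion h1 K hFL ((hsL.psub hsR).mono hFL) hid
  /- (3) the witness -/
  refine ⟨K.frame.toFinset, (bigFrame K).toList.toFinset, hFL, h8, h0, hz, (K.mu : ℝ),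
    Fintype.card (GramIdx K), (gramMat K).submatrix (Fintype.equivFin (GramIdx K)).symm (Fintype.equivFin (GramIdx K)).symm,
    ?_, gramGen K (bigFrame K).toList.toFinset ∘ (Fintype.equivFin (GramIdx K)).symm,
    K.eom.length, fun k => polyOp K.frame.toFinset (K.eom.get k),
    (ttList K).length, fun l => ((ttList K).get l).γ, fun l => ((ttList K).get l).v, hshf,
    fun l => ((((ttList K).get l).z : ℚ) : ℂ) • wordOp K.frame.toFinset ((ttList K).get l).u,
    K.charged.length, fun j => (((K.charged.get j).1 : ℚ) : ℂ),
    fun j => orbWord (bigFrame K).toList.toFinset hz (K.charged.get j).2, ?_,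
    K.wardP.length, fun r => polyOp (bigFrame K).toList.toFinset (K.wardP.get r),
    K.wardM.length, fun r => polyOp (bigFrame K).toList.toFinset (K.wardM.get r),
    K.antiH.length, fun m => (((K.antiH.get m).1 : ℚ) : ℝ),
    fun m => polyOp (bigFrame K).toList.toFinset (K.antiH.get m).2,
    K.slack.length, fun k => (((K.slack.get k).1 : ℚ) : ℂ),
    fun k => orbWord (bigFrame K).toList.toFinset hz (K.slack.get k).2,
    (K.c : ℝ), ?_, ?_⟩
  · /- the Gram multiplier is PSD (diagonal SOS weights ⊕ `scale • L Lᴴ` blocks, re-indexed) -/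
    exact (gramMat_posSemidef K (fun g hg => (hgram' g hg).1) (fun B hB => (hgM' B hB).1)).submatrix _
  · /- charged words carry a charge -/
    intro j _
    rw [ladderCharge_orbWord, ladderSpinCharge_orbWord]
    exact (hch' _ (List.get_mem _ j)).2
  · /- THE IDENTITY in `𝔄_{Λ'⁺}` -/
    unfold WardD4Identity
    dsimp only
    -- left-hand side
    have hLHS : polyOp (bigFrame K).toList.toFinset (lhsPoly K) =
        fermionEmbed (PolySite.incl h0) ((hubbardTTPrimeFermionInteraction 1 0 8).meanEnergyObs 1) -
          ((K.c : ℝ) : ℂ) • (1 : FermionOp (bigFrame K).toList.toFinset) -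
          (((K.mu : ℝ) : ℝ) : ℂ) • (nAt 0 hz 0 + nAt 0 hz 1 -
            (((7 / 8 : ℝ) : ℝ) : ℂ) • (1 : FermionOp (bigFrame K).toList.toFinset)) := by
      rw [lhsPoly, polyOp_append, polyOp_append, polyOp_pscale, polyOp_append, polyOp_append, hEL h0, hDL hz 0,
        hDL hz 1, polyOp_single, polyOp_single, wordOp_nil]
      push_cast
      module
    -- Gram part (SOS factors + matrix blocks, one re-indexed Gram form)
    have hG : gramForm ((gramMat K).submatrix (Fintype.equivFin (GramIdx K)).symm (Fintype.equivFin (GramIdx K)).symm)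
          (gramGen K (bigFrame K).toList.toFinset ∘ (Fintype.equivFin (GramIdx K)).symm) =
        polyOp (bigFrame K).toList.toFinset (K.gram.flatMap fun g => pscale g.1 (pmul (padj g.2) g.2)) +
          polyOp (bigFrame K).toList.toFinset (K.gramM.flatMap gramBlockPoly) := by
      rw [gramForm_reindex, gramForm_gramMat K _ (fun B hB => (hgM' B hB).2.1)]
    -- EOM part
    have hE : polyOp (bigFrame K).toList.toFinset (K.eom.flatMap fun B => comm (hamPoly K.frame) B) =
        ∑ k : Fin K.eom.length,
          ((hubbardTTPrimeFermionInteraction 1 0 8).localHamiltonian (bigFrame K).toList.toFinset *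
              fermionEmbed (PolySite.incl hFL) (polyOp K.frame.toFinset (K.eom.get k)) -
            fermionEmbed (PolySite.incl hFL) (polyOp K.frame.toFinset (K.eom.get k)) *
              (hubbardTTPrimeFermionInteraction 1 0 8).localHamiltonian (bigFrame K).toList.toFinset) := by
      rw [polyOp_flatMap, ← sum_fin_get]
      refine Finset.sum_congr rfl fun k _ => ?_
      have hB : PSupp (K.eom.get k) K.inner.toFinset := PSupp_of_psuppIn (heom' _ (List.get_mem _ k))
      rw [polyOp_comm, polyOp_incl hFL (hamPoly K.frame) (PSupp_hamPoly K.frame), hHF, polyOp_incl hFL _ (hB.mono hIF'),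
        polyOp_incl hIF' _ hB, ← map_mul, ← map_mul, ← map_sub, ← ham_commutator_transfer hIF' hthF hFL]
    -- explicit moves
    have hMv : polyOp (bigFrame K).toList.toFinset
          (K.moves.flatMap fun mv => [(mv.z, moveWord mv.γ mv.v mv.u), (-mv.z, mv.u)]) =
        ((K.moves.map fun mv => (⟨mv.z, mv.u, mv.γ, mv.v⟩ : IdUse)).map (useOp (bigFrame K).toList.toFinset)).sum := by
      rw [polyOp_flatMap, List.map_map]
      congr 1
      refine List.map_congr_left fun mv _ => ?_
      simp only [Function.comp, useOp, polyOp_cons, polyOp_nil, add_zero]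
      push_cast
      module
    -- the identification family
    have hT : ∑ l : Fin (ttList K).length,
        (fermionEmbed (PolySite.incl (hshf l))
            (fermionEmbed (PolySite.d4Emb ((ttList K).get l).γ ((ttList K).get l).v K.frame.toFinset)
              (((((ttList K).get l).z : ℚ) : ℂ) • wordOp K.frame.toFinset ((ttList K).get l).u)) -
          fermionEmbed (PolySite.incl hFL)
            (((((ttList K).get l).z : ℚ) : ℂ) • wordOp K.frame.toFinset ((ttList K).get l).u)) =
        ((ttList K).map (useOp (bigFrame K).toList.toFinset)).sum := by
      rw [← sum_fin_get]
      refine Finset.sum_congr rfl fun l _ => ?_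
      have hu : SuppIn ((ttList K).get l).u K.frame.toFinset := htt _ (List.get_mem _ l)
      rw [map_smul, map_smul, map_smul, ← wordOp_moveWord (hshf l) _ hu, ← wordOp_incl hFL _ hu, useOp, smul_sub]
    -- charged words
    have hC : polyOp (bigFrame K).toList.toFinset K.charged =
        ∑ j : Fin K.charged.length, (((K.charged.get j).1 : ℚ) : ℂ) •
          ladderWord (orbWord (bigFrame K).toList.toFinset hz (K.charged.get j).2) := by
      rw [polyOp, ← sum_fin_get]
      refine Finset.sum_congr rfl fun j _ => ?_
      rw [ladderWord_orbWord _ _ _ ((SuppIn_of_suppIn (hch' _ (List.get_mem _ j)).1).mono hFL)]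
    -- Ward families
    have hP : polyOp (bigFrame K).toList.toFinset (K.wardP.flatMap fun X => comm (spinPlusPoly K.frame) X) =
        ∑ r : Fin K.wardP.length,
          ((spinPlus : FermionOp (bigFrame K).toList.toFinset) * polyOp (bigFrame K).toList.toFinset (K.wardP.get r) -
            polyOp (bigFrame K).toList.toFinset (K.wardP.get r) * spinPlus) := by
      rw [polyOp_flatMap, ← sum_fin_get]
      refine Finset.sum_congr rfl fun r _ => ?_
      have hX : PSupp (K.wardP.get r) K.frame.toFinset := PSupp_of_psuppIn (hwp' _ (List.get_mem _ r))
      rw [polyOp_comm, polyOp_incl hFL (spinPlusPoly K.frame) (PSupp_spinPlusPoly K.frame), hSpF, polyOp_incl hFL _ hX,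
        ← map_mul, ← map_mul, ← map_sub, ← spinPlus_commutator_transfer hFL]
    have hPm : polyOp (bigFrame K).toList.toFinset (K.wardM.flatMap fun X => comm (spinMinusPoly K.frame) X) =
        ∑ r : Fin K.wardM.length,
          ((spinMinus : FermionOp (bigFrame K).toList.toFinset) * polyOp (bigFrame K).toList.toFinset (K.wardM.get r) -
            polyOp (bigFrame K).toList.toFinset (K.wardM.get r) * spinMinus) := by
      rw [polyOp_flatMap, ← sum_fin_get]
      refine Finset.sum_congr rfl fun r _ => ?_
      have hX : PSupp (K.wardM.get r) K.frame.toFinset := PSupp_of_psuppIn (hwm' _ (List.get_mem _ r))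
      rw [polyOp_comm, polyOp_incl hFL (spinMinusPoly K.frame) (PSupp_spinMinusPoly K.frame), hSmF,
        polyOp_incl hFL _ hX, ← map_mul, ← map_mul, ← map_sub, ← spinMinus_commutator_transfer hFL]
    -- anti-Hermitian parts
    have hA : polyOp (bigFrame K).toList.toFinset (K.antiH.flatMap fun t => pscale t.1 (psub (padj t.2) t.2)) =
        ∑ m : Fin K.antiH.length, ((((K.antiH.get m).1 : ℚ) : ℝ) : ℂ) •
          ((polyOp (bigFrame K).toList.toFinset (K.antiH.get m).2)ᴴ -
            polyOp (bigFrame K).toList.toFinset (K.antiH.get m).2) := by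
      rw [polyOp_flatMap, ← sum_fin_get]
      refine Finset.sum_congr rfl fun m _ => ?_
      rw [polyOp_pscale, polyOp_psub, polyOp_padj, Complex.ofReal_ratCast]
    -- slack words
    have hS : polyOp (bigFrame K).toList.toFinset K.slack =
        ∑ k : Fin K.slack.length, (((K.slack.get k).1 : ℚ) : ℂ) •
          ladderWord (orbWord (bigFrame K).toList.toFinset hz (K.slack.get k).2) := by
      rw [polyOp, ← sum_fin_get]
      refine Finset.sum_congr rfl fun k _ => ?_
      rw [ladderWord_orbWord _ _ _ ((SuppIn_of_suppIn (hsl' _ (List.get_mem _ k))).mono hFL)]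
    -- the right-hand side, family by family
    have hRHS : polyOp (bigFrame K).toList.toFinset (rhsPoly K) =
        polyOp (bigFrame K).toList.toFinset (K.gram.flatMap fun g => pscale g.1 (pmul (padj g.2) g.2)) +
        polyOp (bigFrame K).toList.toFinset (K.gramM.flatMap gramBlockPoly) +
        polyOp (bigFrame K).toList.toFinset (K.eom.flatMap fun B => comm (hamPoly K.frame) B) +
        polyOp (bigFrame K).toList.toFinset
          (K.moves.flatMap fun mv => [(mv.z, moveWord mv.γ mv.v mv.u), (-mv.z, mv.u)]) +
        polyOp (bigFrame K).toList.toFinset K.charged +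
        polyOp (bigFrame K).toList.toFinset (K.wardP.flatMap fun X => comm (spinPlusPoly K.frame) X) +
        polyOp (bigFrame K).toList.toFinset (K.wardM.flatMap fun X => comm (spinMinusPoly K.frame) X) +
        polyOp (bigFrame K).toList.toFinset (K.antiH.flatMap fun t => pscale t.1 (psub (padj t.2) t.2)) +
        polyOp (bigFrame K).toList.toFinset K.slack := by
      simp only [rhsPoly, polyOp_append]
    -- assemble
    have key : polyOp (bigFrame K).toList.toFinset (lhsPoly K) =
        polyOp (bigFrame K).toList.toFinset (rhsPoly K) +
          ((canonUses K).map (useOp (bigFrame K).toList.toFinset)).sum := by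
      rw [← hR]; abel
    conv at hT => rhs; rw [ttList, List.map_append, List.sum_append]
    have hCn := eq_sub_of_add_eq' hT.symm
    rw [← hLHS, key, hRHS, hG, hE, hMv, hC, hP, hPm, hA, hS, hCn]
    abel
  · /- the value -/
    dsimp only
    simp only [norm_ratCast_complex]
    rw [← Rat.cast_sum, sum_fin_get K.slack (fun t => |t.1|)]
    have hv : symValue K = K.c - (K.slack.map fun t => |t.1|).sum := by
      simp only [symValue, qabs_eq_abs]
    rw [hv]
    push_cast
    exact le_rfl

/-- S1–S4 + S6: every passing syntactic certificate bounds `e₀(t=1, t'=0, U=8, n=7/8)` from below by its value. -/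
theorem energyDensity_ge_of_symCheck (h1 : NfFaithful) (h2 : MoveSound) (h3 : DictionarySound)
    (h4 : NfFaithful → MoveSound → DictionarySound → SymCheckSound) (h6 : WardD4WindowSound)
    (K : SymCert) (hK : symCheck K = true) :
    ((symValue K : ℚ) : ℝ) ≤ energyDensityTT' 1 0 8 (7 / 8) :=
  energyDensity_ge_of_windowSound_cert _ h6 (h4 h1 h2 h3 K hK)

/-- **UNCONDITIONAL (S1–S4 + S6 proved): every syntactic certificate passing `symCheck` bounds the
thermodynamic-limit ground-state energy density `e₀(t=1, t'=0, U=8, n=7/8)` from below by its value.**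
No hypothesis, no claim node, axioms `propext / Classical.choice / Quot.sound`; what remains for the crux is
ONLY the data stub S5 (a passing certificate of value `≥` the edge constant). -/
theorem energyDensity_ge_symValue (K : SymCert) (hK : symCheck K = true) :
    ((symValue K : ℚ) : ℝ) ≤ energyDensityTT' 1 0 8 (7 / 8) :=
  energyDensity_ge_of_symCheck stub_nfFaithful stub_moveSound stub_dictionarySound stub_soundOfKernels
    WardSlot.stub_wardWindowSound K hK

/-- **The first kernel-replayed window certificate, end to end, NO hypothesis**: the 17-factor toy SOS
certificate `toyCert` (checked by `decide +kernel`) gives `−23/4 ≤ e₀(8, 7/8, 0)`. (Value-wise trivial —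
the tree's unconditional floor is `−1.0432` — but every stage S1 · S2 · S3 · S4 · S6 is now kernel-closed.) -/
theorem toyCert_energy_ge : (((-23) / 4 : ℚ) : ℝ) ≤ energyDensityTT' 1 0 8 (7 / 8) := by
  have h := energyDensity_ge_symValue toyCert toyCert_check
  rwa [toyCert_value] at h

/-- The same from the matrix-form (`gramM`) toy certificate. -/
theorem toyCertM_energy_ge : ((symValue toyCertM : ℚ) : ℝ) ≤ energyDensityTT' 1 0 8 (7 / 8) :=
  energyDensity_ge_symValue toyCertM toyCertM_check.1

end Summit.Ventures.CertifiedManyBodySolver.Theorems.SymReplay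

end
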